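import Summits.CriticalPhenomena.CardyFormulaZ2.Theses.CardyMeckeFlip
import Literature.Probability.Percolation.FlipFairKernel

/-!
# Strategy census for crux `MeckeRigidity` (stmt-CriticalPhenomena-14826) — typed companion

Crux-strategist unit `cstrat-stmt-CriticalPhenomena-14826-s1` (route `CardyMeckeFlip`, sub-problem
`CriticalPhenomena/CardyFormulaZ2`).  This file is the kernel-checked companion of `STRATEGY-CENSUS.md`: it types
the four switches of the census (transfer / strengthen / decomposition / negation) against the crux BY NAME and
proves the bookkeeping implications, so that the census can say *exactly which piece* of each switch inherits the
refuters' tilted-FK(q) witness.  It files nothing and registers no line (the crux as typed is conjecturally FALSE —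
free kernel `M` under (ADM) only — so no sound skeleton can conclude it; see the census).

Contents (all sorry-free):

* §0 `IsModel P M` — the six clauses (prob, (E2), (D), (RSW ∃c), (ADM)+equivariance, (F) ∀ε, (EXT)) bundled with the
  named predicates of `FlipFairKernel.lean`; `HasCardyValues P`; `meckeRigidity_iff_models` — the crux is LITERALLY
  "every six-clause model has Cardy values"; `not_meckeRigidity_iff` — its negation is "some model is non-Cardy".
* §1 Decomposition: `CanonicalRigidity Can` / `KernelReduction Can` for an arbitrary kernel-canonicity predicate
  `Can` (instances: c5's (CAN′) `IsImportanceContentKernel`, the lattice `IsZ2PivotalKernelLimit`), the proved join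
  `meckeRigidity_of_split`, and `not_kernelReduction_of_witness` — given a non-Cardy model and the (believed) canonical
  rigidity, the reduction half is the piece that is false.  `split_inherits_witness` is the general form.
* §2 Strengthen: `ModelUniqueness`, `CardyModelExists`, `meckeRigidity_of_uniqueness` (the registered line's shape,
  without its scale-invariance detour) and `not_modelUniqueness_of_two_models`.
* §3 Transfer: `MeckeRigidityDeterministic` — Mecke's literal template (STATE-INDEPENDENT intensity) — is a
  specialisation of the crux (`meckeRigidityDeterministic_of_meckeRigidity`); the converse direction, which is what a
  transfer of Last–Penrose Thm 4.1 would need, is exactly where the kernel's state-dependence breaks the argument.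
* §4 Negation: `not_meckeRigidity_of_model` — the typed target of any refutation: ONE pair `(P, M)` with `IsModel P M`
  and a non-Cardy crossing value.
-/

noncomputable section

open MeasureTheory Set Filter Topology
open Literature.Probability.Percolation Literature.Probability.Percolation.QuadCrossing
open Literature.Probability.RandomPlanarGeometry

namespace Summit.CriticalPhenomena.CardyFormulaZ2.Cruxes.MeckeRigidity.StrategyCensus

/-! ### §0 The six clauses, bundled; the crux is "every model is Cardy" -/

/-- (E2): the law is invariant under every plane isometry. -/
def IsIsometryInvariantLaw (P : Measure (QuadConfig (univ : Set ℂ))) : Prop :=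
  ∀ g : ℂ ≃ᵢ ℂ, Measure.map (QuadConfig.isometry g) P = P

/-- (D): exact self-duality of the finite-dimensional crossing marginals (transposed quads). -/
def IsSelfDualLaw (P : Measure (QuadConfig (univ : Set ℂ))) : Prop :=
  ∀ (n : ℕ) (Q Qt : Fin n → Quad (univ : Set ℂ)),
    (∀ i, (Qt i).carrier = (Q i).carrier ∧ (Qt i).side 0 = (Q i).side 1 ∧
      (Qt i).side 1 = (Q i).side 2 ∧ (Qt i).side 2 = (Q i).side 3 ∧ (Qt i).side 3 = (Q i).side 0) →
    ∀ A : Set (Set (Fin n)), P {S | {i | Q i ∈ S} ∈ A} = P {S | {i | Qt i ∉ S} ∈ A}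

/-- (RSW) with constant `c`: every `3a × a` rectangle is crossed the long way with probability `≥ c`. -/
def HasRSWBound (P : Measure (QuadConfig (univ : Set ℂ))) (c : ℝ) : Prop :=
  ∀ (a x y : ℝ), 0 < a → ∀ Q : Quad (univ : Set ℂ),
    Q.carrier = {w : ℂ | x ≤ w.re ∧ w.re ≤ x + 3 * a ∧ y ≤ w.im ∧ w.im ≤ y + a} →
    Q.side 0 = {w : ℂ | w.re = x ∧ y ≤ w.im ∧ w.im ≤ y + a} →
    Q.side 2 = {w : ℂ | w.re = x + 3 * a ∧ y ≤ w.im ∧ w.im ≤ y + a} →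
      c ≤ P.real (QuadConfig.crossedEvent Q)

/-- The conclusion of the crux for a law `P`: every quad of a conformal rectangle has its Cardy value. -/
def HasCardyValues (P : Measure (QuadConfig (univ : Set ℂ))) : Prop :=
  ∀ (R : ConformalRectangle) (φ : ConformalEquiv UpperHalfPlane.upperHalfPlaneSet R.carrier) (x : Fin 4 → ℝ),
    R.IsUniformizing φ x → ∀ Q : Quad (univ : Set ℂ),
      Q.carrier = closure R.carrier → Q.side 0 = R.arc 0 → Q.side 1 = R.arc 1 → Q.side 2 = R.arc 2 →
      Q.side 3 = R.arc 3 → P.real (QuadConfig.crossedEvent Q) = cardyFunction (crossRatio x)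

/-- **A model of the six clauses**: a probability law `P` on `ℋ_ℂ` with (E2), (D), (RSW) for some `c > 0`, and a
kernel family `M` which is admissible, isometry-equivariant, flip-fair at every cutoff and for which `P` is
flip-extremal — exactly the hypotheses of `MeckeRigidity` on `(P, M)` once `Piv` is identified with `IsPivotalAt`. -/
def IsModel (P : Measure (QuadConfig (univ : Set ℂ))) (M : ℝ → QuadConfig (univ : Set ℂ) → Measure ℂ) : Prop :=
  IsProbabilityMeasure P ∧ IsIsometryInvariantLaw P ∧ IsSelfDualLaw P ∧ (∃ c : ℝ, 0 < c ∧ HasRSWBound P c) ∧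
    IsAdmissibleKernel P M ∧ IsIsometryEquivariant M ∧ (∀ ε : ℝ, 0 < ε → IsFlipFairKernel P (M ε)) ∧
    IsFlipExtremal P M

/-- **The crux, unbundled ⟺ bundled.** `MeckeRigidity` is literally the statement that every model of the six
clauses has Cardy values.  (`→`: instantiate the characterised parameter `Piv` at `IsPivotalAt` by `Iff.rfl`;
`←`: identify `Piv` with `IsPivotalAt` by `eq_isPivotalAt_of_forall_iff` and rebundle.) -/
theorem meckeRigidity_iff_models :
    Summit.CriticalPhenomena.CardyFormulaZ2.Theses.CardyMeckeFlip.MeckeRigidity ↔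
      ∀ (P : Measure (QuadConfig (univ : Set ℂ))) (M : ℝ → QuadConfig (univ : Set ℂ) → Measure ℂ),
        IsModel P M → HasCardyValues P := by
  constructor
  · intro hK2 P M hPM R φ x hφx Q hQc h0 h1 h2 h3
    obtain ⟨hprob, hE2, hD, ⟨c, hc, hRSW⟩, hADM, hEqv, hF, hEXT⟩ := hPM
    have h6 := (isAdmissibleKernel_and_isIsometryEquivariant_iff P M).1 ⟨hADM, hEqv⟩
    exact hK2 (fun S x Q => S.IsPivotalAt x Q) (fun _ _ _ => Iff.rfl) P M hprob hE2 hD c hc hRSW h6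
      (fun ε hε => hF ε hε) hEXT R φ x hφx Q hQc h0 h1 h2 h3
  · intro h Piv hPiv P M hprob hE2 hD c hc hRSW hADM hF hEXT R φ x hφx Q hQc h0 h1 h2 h3
    obtain rfl : Piv = fun S x Q => S.IsPivotalAt x Q := QuadConfig.eq_isPivotalAt_of_forall_iff hPiv
    have hAE : IsAdmissibleKernel P M ∧ IsIsometryEquivariant M :=
      (isAdmissibleKernel_and_isIsometryEquivariant_iff P M).2 hADM
    exact h P M ⟨hprob, hE2, hD, ⟨c, hc, hRSW⟩, hAE.1, hAE.2, fun ε hε => hF ε hε, hEXT⟩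
      R φ x hφx Q hQc h0 h1 h2 h3

/-! ### §4 (stated first, used below) Negation: the typed target of any refutation -/

/-- **Negation target.** One model of the six clauses with a non-Cardy value refutes the crux.  The refuters'
tilted-FK(q) witness (self-dual critical FK(q), `1 < q ≤ 4`, with the `q^{σ/4}`-tilted `ε`-pivotal kernel) is
claimed to be such a pair; it is not constructible in the tree (XL inputs symmetric to CLE₆'s). -/
theorem not_meckeRigidity_of_model {P : Measure (QuadConfig (univ : Set ℂ))}
    {M : ℝ → QuadConfig (univ : Set ℂ) → Measure ℂ} (hPM : IsModel P M) (hnc : ¬ HasCardyValues P) :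
    ¬ Summit.CriticalPhenomena.CardyFormulaZ2.Theses.CardyMeckeFlip.MeckeRigidity :=
  fun hK2 => hnc (meckeRigidity_iff_models.1 hK2 P M hPM)

/-- `¬ MeckeRigidity` is EXACTLY the existence of a non-Cardy model (no hidden third option: the crux is not
"summit-hard", it is decided by the model class of its own hypotheses). -/
theorem not_meckeRigidity_iff :
    ¬ Summit.CriticalPhenomena.CardyFormulaZ2.Theses.CardyMeckeFlip.MeckeRigidity ↔
      ∃ (P : Measure (QuadConfig (univ : Set ℂ))) (M : ℝ → QuadConfig (univ : Set ℂ) → Measure ℂ),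
        IsModel P M ∧ ¬ HasCardyValues P := by
  rw [meckeRigidity_iff_models]
  simp only [not_forall, exists_prop]

/-! ### §1 Decomposition: canonical-kernel rigidity + kernel reduction -/

/-- **Sub₁ — rigidity for CANONICAL kernels.** For a kernel-canonicity predicate `Can` (e.g. c5's (CAN′)
`IsImportanceContentKernel`: `M ε S` is the normalised Minkowski content of the `ε`-important points of `S`;
or the lattice `IsZ2PivotalKernelLimit`), every model whose kernel is canonical has Cardy values.  With a
state-blind `Can` the flip identity (F) regains its fair-coin content and the tilted-FK witness violates `Can`;
honest status: OPEN PROBLEM (isotropic self-dual flip-ergodic universality), believed true. -/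
def CanonicalRigidity
    (Can : Measure (QuadConfig (univ : Set ℂ)) → (ℝ → QuadConfig (univ : Set ℂ) → Measure ℂ) → Prop) : Prop :=
  ∀ (P : Measure (QuadConfig (univ : Set ℂ))) (M : ℝ → QuadConfig (univ : Set ℂ) → Measure ℂ),
    IsModel P M → Can P M → HasCardyValues P

/-- **Sub₂ — kernel reduction.** Every model `(P, M)` admits a CANONICAL kernel `M'` for the same law with all six
clauses.  This is the half that inherits the witness: for the tilted-FK law it would produce a state-blind flip-fair
kernel, which (F)'s fair-coin content forbids for `q ≠ 1` (lattice defect ≠ 0) — conjecturally FALSE. -/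
def KernelReduction
    (Can : Measure (QuadConfig (univ : Set ℂ)) → (ℝ → QuadConfig (univ : Set ℂ) → Measure ℂ) → Prop) : Prop :=
  ∀ (P : Measure (QuadConfig (univ : Set ℂ))) (M : ℝ → QuadConfig (univ : Set ℂ) → Measure ℂ),
    IsModel P M → ∃ M' : ℝ → QuadConfig (univ : Set ℂ) → Measure ℂ, IsModel P M' ∧ Can P M'

/-- **The join is proved** (so the split is a genuine typed decomposition of the crux, for every `Can`). -/
theorem meckeRigidity_of_split
    (Can : Measure (QuadConfig (univ : Set ℂ)) → (ℝ → QuadConfig (univ : Set ℂ) → Measure ℂ) → Prop) :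
    CanonicalRigidity Can → KernelReduction Can →
      Summit.CriticalPhenomena.CardyFormulaZ2.Theses.CardyMeckeFlip.MeckeRigidity := by
  intro h₁ h₂
  refine meckeRigidity_iff_models.2 fun P M hPM => ?_
  obtain ⟨M', hPM', hCan⟩ := h₂ P M hPM
  exact h₁ P M' hPM' hCan

/-- **Which piece inherits the witness.** Given a non-Cardy model and the canonical rigidity `Sub₁`, the reduction
`Sub₂` is false — for EVERY choice of `Can`.  So no `--split` of the crux as typed has two true children. -/
theorem not_kernelReduction_of_witness
    (Can : Measure (QuadConfig (univ : Set ℂ)) → (ℝ → QuadConfig (univ : Set ℂ) → Measure ℂ) → Prop)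
    {P : Measure (QuadConfig (univ : Set ℂ))} {M : ℝ → QuadConfig (univ : Set ℂ) → Measure ℂ}
    (hPM : IsModel P M) (hnc : ¬ HasCardyValues P) (h₁ : CanonicalRigidity Can) : ¬ KernelReduction Can :=
  fun h₂ => not_meckeRigidity_of_model hPM hnc (meckeRigidity_of_split Can h₁ h₂)

/-- **General form**: any two-piece decomposition with a proved join loses one piece to a non-Cardy model. -/
theorem split_inherits_witness {Sub₁ Sub₂ : Prop}
    (hjoin : Sub₁ → Sub₂ → Summit.CriticalPhenomena.CardyFormulaZ2.Theses.CardyMeckeFlip.MeckeRigidity)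
    {P : Measure (QuadConfig (univ : Set ℂ))} {M : ℝ → QuadConfig (univ : Set ℂ) → Measure ℂ}
    (hPM : IsModel P M) (hnc : ¬ HasCardyValues P) : Sub₁ → ¬ Sub₂ :=
  fun h₁ h₂ => not_meckeRigidity_of_model hPM hnc (hjoin h₁ h₂)

/-! ### §2 Strengthen: uniqueness of the model (the registered line's shape) -/

/-- **S⁺ — model uniqueness**: any two models of the six clauses have the same law.  (The registered skeleton
`Lines/birth.lean` reaches this through scale invariance + the equal-or-singular dichotomy; here it is the bare
strengthening.)  Inherits the witness: CLE₆'s and CLE₁₆/₃'s quad laws would be two distinct models. -/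
def ModelUniqueness : Prop :=
  ∀ (P P' : Measure (QuadConfig (univ : Set ℂ))) (M M' : ℝ → QuadConfig (univ : Set ℂ) → Measure ℂ),
    IsModel P M → IsModel P' M' → P = P'

/-- **The Cardy model exists** (XL, `stub_cardyModel` of the registered line: CLE₆ quad law + GPS kernel; (EXT) =
ergodicity of Euclidean dynamical percolation, GHSS arXiv:1905.06940 Thm 1.4(i)). -/
def CardyModelExists : Prop :=
  ∃ (P : Measure (QuadConfig (univ : Set ℂ))) (M : ℝ → QuadConfig (univ : Set ℂ) → Measure ℂ),
    IsModel P M ∧ HasCardyValues P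

/-- S⁺ plus the Cardy model give the crux (so S⁺ is a genuine strengthening modulo the XL existence input). -/
theorem meckeRigidity_of_uniqueness :
    ModelUniqueness → CardyModelExists →
      Summit.CriticalPhenomena.CardyFormulaZ2.Theses.CardyMeckeFlip.MeckeRigidity := by
  intro hU ⟨P₀, M₀, hPM₀, hC₀⟩
  refine meckeRigidity_iff_models.2 fun P M hPM => ?_
  obtain rfl : P = P₀ := hU P P₀ M M₀ hPM hPM₀
  exact hC₀

/-- S⁺ inherits the witness in the crudest way: two models with different laws kill it. -/
theorem not_modelUniqueness_of_two_models {P P' : Measure (QuadConfig (univ : Set ℂ))}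
    {M M' : ℝ → QuadConfig (univ : Set ℂ) → Measure ℂ} (hPM : IsModel P M) (hPM' : IsModel P' M')
    (hne : P ≠ P') : ¬ ModelUniqueness :=
  fun hU => hne (hU P P' M M' hPM hPM')

/-! ### §3 Transfer: Mecke's literal template has a STATE-INDEPENDENT intensity -/

/-- **Mecke's template, transferred literally**: the crux restricted to kernels that do not depend on the
configuration, `M ε S = m ε` (as the intensity measure `λ` of the Mecke equation, Last–Penrose Thm 4.1, is a fixed
measure).  It is a SPECIAL CASE of the crux, hence weaker; it cannot feed `closes` (K3 supplies state-dependent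
GPS kernels), and the uniqueness mechanism of Thm 4.1 (the recursion `k·π_k = λ(B)·π_{k-1}` uses that `λ(B)` is a
number, not a random variable) has no analogue once `M` depends on `S`: the state-dependent analogue of Mecke's
equation is the GNZ equation, which characterises a Gibbs CLASS, not a law. -/
def MeckeRigidityDeterministic : Prop :=
  ∀ (P : Measure (QuadConfig (univ : Set ℂ))) (m : ℝ → Measure ℂ), IsModel P (fun ε _ => m ε) → HasCardyValues P

/-- The literal transfer is implied by the crux (specialisation to constant kernel families). -/
theorem meckeRigidityDeterministic_of_meckeRigidity
    (hK2 : Summit.CriticalPhenomena.CardyFormulaZ2.Theses.CardyMeckeFlip.MeckeRigidity) :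
    MeckeRigidityDeterministic :=
  fun P m hPM => meckeRigidity_iff_models.1 hK2 P (fun ε _ => m ε) hPM

end Summit.CriticalPhenomena.CardyFormulaZ2.Cruxes.MeckeRigidity.StrategyCensus

end
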